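import Summits.Ventures.PercRepro.RankLevelSetLevelSixT23Cell7
import Summits.Ventures.PercRepro.RankLevelSetLevelSixT23Cell8B
import Summits.Ventures.PercRepro.RankLevelSetLevelSixT23Cell9B
import Summits.Ventures.PercRepro.RankLevelSetLevelSixT23Cell10C
import Summits.Ventures.PercRepro.RankLevelSetLevelSixT23Cell11B
import Summits.Ventures.PercRepro.RankLevelSetLevelSixT23Cell12B
import Summits.Ventures.PercRepro.RankLevelSetLevelSixT23CellsEveryA
import Summits.Ventures.PercRepro.RankLevelSetLevelSixT23CellsEveryB
import Summits.Ventures.PercRepro.RankLevelSetLevelSixT23Cell20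
import Summits.Ventures.PercRepro.RankLevelSetLevelSixT23BasisMid1
import Summits.Ventures.PercRepro.RankLevelSetLevelSixT23BasisMid2
import Summits.Ventures.PercRepro.RankLevelSetLevelSixT23RegII
import Summits.Ventures.PercRepro.RankLevelSetLevelSixBasisSq24

/-!
# PercRepro — C-025 AT LEVEL `6` FOR EVERY `p ≥ 23`, EVERY FINITE MATROID, UNCONDITIONAL: THE 23 ROW (p8 g11, S3)

`proofs/SUBCLAIM-S3-p8.md` §3y. Every core cell `(23, d)`, `d ≥ 7`, is a tree theorem: `d = 7` by the coloop-free cell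
with THE TRIANGLE DROP and a one-level coloop split (`c025_core_six_twentythree_7`); `d = 8` by the two-case split of the
coloop-free core — a rank-`≤ 5` set of `12` points (`#U ≤ 19·2508`) or none (`UH = ∅` on the cell `sq27di2v`) — and a
3-level coloop split (`c025_core_six_twentythree_8`); `d = 9, 10, 11, 12` by the coloop-free cells on `sq27di2v`
(THE `H`-TERM FACTOR) and the 3- / 5- / 3- / 4-level coloop splits; `13 ≤ d ≤ 19` by the every-core cells on `sq27di2v`;
`d = 20` by the coloop-free cell and the cell with a coloop (the DI3 cell); `21 ≤ d ≤ 38` by the basis cell; `d ≥ 39` by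
regime II. Hence (`rls_six_at_of_core 23` on p7's `c025_five_large_sharp19` and the `24` row) **level `6` holds for every
`p ≥ 23`** (`c025_six_large_twenty_three`). Axioms: standard.
-/

open scoped Matroid

namespace PercRepro

namespace ThmN

open Set

variable {α : Type}

/-- **The core cell `(23, d)` at every corank `d ≥ 13`, every `e`-free core.** -/
theorem c025_core_six_twentythree_large (M : Matroid α) [M.Finite] (d : ℕ) (hd13 : 13 ≤ d)
    (hR : M.eRank = (23 : ℕ∞)) (hn : M.E.ncard = 23 + d)
    (hfree : ∀ e ∈ M.E, ∃ A ⊆ M.E \ {e}, e ∉ M.closure A ∧ e ∉ M.closure ((M.E \ {e}) \ A)) :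
    RLS M 23 6 := by
  rcases Nat.lt_or_ge d 21 with h20 | h21
  · interval_cases d
    · exact c025_core_six_t23_every13 M 23 (le_refl 23) hR hn hfree
    · exact c025_core_six_t23_every14 M 23 (le_refl 23) hR hn hfree
    · exact c025_core_six_t23_every15 M 23 (le_refl 23) hR hn hfree
    · exact c025_core_six_t23_every16 M 23 (le_refl 23) hR hn hfree
    · exact c025_core_six_t23_every17 M 23 (le_refl 23) hR hn hfree
    · exact c025_core_six_t23_every18 M 23 (le_refl 23) hR hn hfree
    · exact c025_core_six_t23_every19 M 23 (le_refl 23) hR hn hfree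
    · exact c025_core_six_twentythree_20 M hR hn hfree
  rcases Nat.lt_or_ge d 30 with h29 | h30
  · exact c025_core_six_t23_basis_mid1 M d h21 (by omega) hR hn hfree
  rcases Nat.lt_or_ge d 39 with h38 | h39
  · exact c025_core_six_t23_basis_mid2 M d h30 (by omega) hR hn hfree
  · exact c025_core_six_regII_basis_23 M d h39 hR hn hfree

/-- **The core cell `(23, d)` at every corank `d ≥ 7`, every `e`-free core.** -/
theorem c025_core_six_twentythree (M : Matroid α) [M.Finite] (d : ℕ) (hd7 : 7 ≤ d)
    (hR : M.eRank = (23 : ℕ∞)) (hn : M.E.ncard = 23 + d)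
    (hfree : ∀ e ∈ M.E, ∃ A ⊆ M.E \ {e}, e ∉ M.closure A ∧ e ∉ M.closure ((M.E \ {e}) \ A)) :
    RLS M 23 6 := by
  rcases Nat.lt_or_ge d 13 with h12 | h13
  · interval_cases d
    · exact c025_core_six_twentythree_7 M hR hn hfree
    · exact c025_core_six_twentythree_8 M hR hn hfree
    · exact c025_core_six_twentythree_9 M hR hn hfree
    · exact c025_core_six_twentythree_10 M hR hn hfree
    · exact c025_core_six_twentythree_11 M hR hn hfree
    · exact c025_core_six_twentythree_12 M hR hn hfree
  · exact c025_core_six_twentythree_large M d h13 hR hn hfree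

/-- **THEOREM C₆ AT RANK `23`, GIVEN LEVEL `5`**: level `5` for all `p ≥ 22` implies level `6` for all `p ≥ 23`
(`p = 23` by the core cells above and `rls_six_at_of_core`; `p ≥ 24` by the `24` row). -/
theorem c025_six_of_five_t23 (h5 : ∀ (M : Matroid α) [M.Finite] (p : ℕ), 22 ≤ p → RLS M p 5) :
    ∀ (M : Matroid α) [M.Finite] (p : ℕ), 23 ≤ p → RLS M p 6 := by
  intro M _ p hp
  rcases Nat.lt_or_ge p 24 with hlt | hge
  · have hP : p = 23 := by omega
    subst hP
    refine rls_six_at_of_core 23 (by norm_num) (fun M _ => h5 M 22 (by norm_num)) ?_ M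
    intro M _ d hd hR hn hfree
    exact c025_core_six_twentythree M d hd hR hn hfree
  · exact c025_six_large_twenty_four M p hge

/-- **C-025 AT LEVEL `6` FOR EVERY `p ≥ 23`, EVERY FINITE MATROID, UNCONDITIONAL** — `c025_six_of_five_t23` on p7's
level-`5` row `c025_five_large_sharp19 (19 ≤ p)`. -/
theorem c025_six_large_twenty_three (M : Matroid α) [M.Finite] (p : ℕ) (hp : 23 ≤ p) : RLS M p 6 :=
  c025_six_of_five_t23 (fun M _ p hp => c025_five_large_sharp19 M p (by omega)) M p hp

/-- The same in the vocabulary of `C025`: the level-`6` frontier is every `p ≥ 23`. -/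
theorem c025_six_large_twenty_three' (M : Matroid α) [M.Finite] (p : ℕ) (hp : 23 ≤ p) :
    phiK p 6 * ({A : Set α | A ⊆ M.E ∧ M.eRk A = (p : ℕ∞) ∧ M.eRk (M.E \ A) = (6 : ℕ∞)}.ncard : ℚ) ≤
      ({A : Set α | A ⊆ M.E ∧ (6 : ℕ∞) < M.eRk A ∧ M.eRk A < (p : ℕ∞)}.ncard : ℚ) :=
  c025_six_large_twenty_three M p hp

end ThmN

end PercRepro
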